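import Literature.NumberTheory.EllipticCurves.RationalTwoTorsionModPIrreducibleProofs
import Literature.NumberTheory.Automorphic.CDTTheorem722SerreProofs
import Literature.NumberTheory.EllipticCurves.Szpiro
import HarnessLib

/-!
# Crux `FreyModularity` (stmt-ABC-11340), line `Sketch`: the stub
# `isIrreducible_freyCurve_five_of_degree_ne_twenty` (S4a refined: `X₀(20)` instead of Mazur–Kenku)

The line `Sketch` of the crux `Summit.ABC.ABC.Theses.DefiniteXi.FreyModularity` needs, for every
Frey curve `E_(a,b) : y² = x(x − a)(x + b)` (`ab(a+b) ≠ 0`), that every framed model `ρ̄` of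
`E[5]` is **irreducible** (the Frey-specific replacement of Elkies' Lemma 7.2.3 in
Conrad–Diamond–Taylor 1999, proof of Thm. 7.1.2).  The skeleton obtained this from the full
Mazur–Kenku classification of rational cyclic isogenies (`mazurKenku_exists_cyclic_isogeny`,
Mazur 1978, Thm. 1; Kenku 1982), through the tree's theorem
`hasIrreducibleModPGaloisRep_of_rational_two_torsion_of_mazurKenku` (Darmon–Merel 1997, Thm. 2.2,
proved in the tree by the road through `X₀(4p)`).  Mathematically only **`X₀(20)(ℚ)` = cusps**
(Kubert 1976; Kenku 1982: there is no `ℚ`-rational cyclic `20`-isogeny) is used, and this file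
makes that precise:

* `hasIrreducibleModPGaloisRep_of_rational_two_torsion_of_degree_ne` — for an elliptic curve
  `E/ℚ` all of whose `2`-torsion points are `Γ_ℚ`-fixed and an odd prime `p`, **if no two elliptic
  curves over `ℚ` are joined by a cyclic `ℚ`-isogeny of degree `4p`, then `ρ̄_{E,p}` is
  irreducible**.  The proof is Steps 1–4 of the tree's proof of
  `hasIrreducibleModPGaloisRep_of_rational_two_torsion_of_mazurKenku`, verbatim: a `Γ_ℚ`-stable
  line `C = ⟨s₀⟩ ⊂ E[p]` and two independent rational `2`-torsion points `P = 2R`, `Q` give, on the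
  `2`-isogenous curve `E₁ = E/⟨Q⟩` (`g₁ : E → E₁`, *AEC* III.4.12), the `Γ_ℚ`-stable **cyclic**
  subgroup `K = ⟨g₁ R + g₁ s₀⟩` of order `4p`, hence (III.4.12 again) a cyclic `ℚ`-isogeny
  `g₂ : E₁ → E₂ = E₁/K` of degree `#K = 4p` — excluded by hypothesis.  (Steps 5–7 of the tree's
  proof, which unwind the existential Mazur–Kenku fact, are not needed.)
* `isIrreducible_freyCurve_five_of_degree_ne_twenty` — THE STUB: **if no cyclic `ℚ`-isogeny
  between elliptic curves over `ℚ` has degree `20`, then for coprime `a, b` with `ab(a+b) ≠ 0`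
  every framed model of `E_(a,b)[5]` is irreducible**: the `2`-torsion of a Frey curve is rational
  (`smul_eq_of_two_nsmul_eq_zero_freyCurve`, Darmon–Merel Lemma 1.2 (1)), so the general theorem
  at `p = 5` (`4 · 5 = 20`) gives `HasIrreducibleModPGaloisRep 5`, transported to framed models by
  `BCDT.isIrreducible_of_hasIrreducibleModPGaloisRep`.

## References

* [DarmonMerel1997] H. Darmon, L. Merel, *Winding quotients and some variants of Fermat's Last
  Theorem*, J. reine angew. Math. 490 (1997) 81–100, Lemma 1.2 (1) and Thm. 2.2.
* [Kenku1982] M. A. Kenku, *On the number of `ℚ`-isomorphism classes of elliptic curves in each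
  `ℚ`-isogeny class*, J. Number Theory 15 (1982) 199–202, Thm. 1; [Kubert1976] D. S. Kubert,
  *Universal bounds on the torsion of elliptic curves*, Proc. London Math. Soc. 33 (1976) 193–237
  (`X₀(20)`); [Mazur1978] B. Mazur, *Rational isogenies of prime degree*, Invent. Math. 44 (1978).
* [SilvermanAEC2009] J. H. Silverman, *The Arithmetic of Elliptic Curves*, GTM 106 (2009),
  Prop. III.4.12, Rem. III.4.13.2, Cor. III.6.4(b).
-/

-- `Summit.<Summit>.<Problem>` is the mandated summit-side namespace (CONVENTIONS §2); for the
-- single-conjunct summit `ABC` the two coincide, so the duplicate `ABC.ABC` is deliberate.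
set_option linter.dupNamespace false

noncomputable section

open scoped MatrixGroups

open Literature.NumberTheory.EllipticCurves
open Literature.NumberTheory.Automorphic
open Literature.NumberTheory.Automorphic.BCDT
open Literature.NumberTheory.GaloisRepresentations
open WeierstrassCurve

namespace Summit.ABC.ABC.Theorems

/-! ## Full rational `2`-torsion and a rational `p`-isogeny give a rational cyclic `4p`-isogeny -/

/-- **Full rational `2`-torsion excludes rational `p`-isogenies, granted that there is no rational
cyclic `4p`-isogeny** (Darmon–Merel 1997, Thm. 2.2, by the road through `X₀(4p)`).  Let `E/ℚ` be
an elliptic curve all of whose `2`-torsion points in `E(ℚ̄)` are fixed by `Γ_ℚ` (Darmon–Merel,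
Lemma 1.2 (1): "all its points of order `2` defined over `ℚ`"), `p` an odd prime, and suppose
that no two elliptic curves over `ℚ` are joined by a cyclic `ℚ`-isogeny of degree `4p` (i.e.
`Y₀(4p)(ℚ) = ∅`; for `p = 5`: Kubert 1976 / Kenku 1982).  Then `ρ̄_{E,p}` is irreducible
(`HasIrreducibleModPGaloisRep`: no `Γ_ℚ`-stable line in `E[p]`).  Proof: a stable line
`C = ⟨s₀⟩ ⊂ E[p]` (`Mazur1978.not_hasIrreducibleModPGaloisRep_iff_exists_natCard_eq`) and two
independent rational `2`-torsion points `P = 2R`, `Q` (`E[2] = {O, P, Q, P + Q}`,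
`eq_zero_or_eq_or_eq_add_of_two_nsmul_eq_zero`) give on `E₁ = E/⟨Q⟩` (the quotient isogeny
`g₁`, `exists_isogeny_ker_eq_and_comp_eq_nsmul_holds`, *AEC* III.4.12 / III.4.13.2) the point
`κ = g₁ R + g₁ s₀` of order `4p` generating a `Γ_ℚ`-stable cyclic subgroup `K` (`σκ − κ ∈
g₁(E[2]) + g₁(C) ⊆ K`), whence a cyclic `ℚ`-isogeny `g₂ : E₁ → E₁/K` of degree `4p` — excluded.
Adapted (Steps 1–4 verbatim) from the tree's
`hasIrreducibleModPGaloisRep_of_rational_two_torsion_of_mazurKenku`.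
[cite: DarmonMerel1997, Thm. 2.2 (with Lemma 1.2 (1))] -/
theorem hasIrreducibleModPGaloisRep_of_rational_two_torsion_of_degree_ne
    (W : WeierstrassCurve ℚ) [W.IsElliptic]
    (h2 : ∀ (σ : Field.absoluteGaloisGroup ℚ) (P : W.geomPoints), 2 • P = 0 → σ • P = P)
    {p : ℕ} (hp : p.Prime) (hp2 : p ≠ 2)
    (h4p : ∀ (W₁ W₂ : WeierstrassCurve ℚ) [W₁.IsElliptic] [W₂.IsElliptic] (φ : Isogeny W₁ W₂),
      φ.IsCyclic → φ.degree ≠ 4 * p) :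
    W.HasIrreducibleModPGaloisRep p := by
  -- adapted from
  -- Literature/NumberTheory/EllipticCurves/RationalTwoTorsionModPIrreducibleProofs.lean
  -- (`hasIrreducibleModPGaloisRep_of_rational_two_torsion_of_mazurKenku`, Steps 1–4 verbatim;
  -- its Steps 5–7, unwinding the existential Mazur–Kenku fact, are replaced by `h4p`)
  classical
  have h2p : 2 < p := lt_of_le_of_ne hp.two_le (Ne.symm hp2)
  haveI : Fact p.Prime := ⟨hp⟩
  haveI : NeZero (p : ℚ) := ⟨Nat.cast_ne_zero.mpr hp.ne_zero⟩
  have hpodd : Odd p := hp.odd_of_ne_two hp2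
  by_contra hred
  obtain ⟨H, hHstab, hHcard⟩ :=
    (Mazur1978.not_hasIrreducibleModPGaloisRep_iff_exists_natCard_eq W p).mp hred
  /- Step 1: the stable line as a finite `Γ_ℚ`-stable subgroup `S = ⟨s₀⟩` of `E(ℚ̄)`, order `p`. -/
  set S : AddSubgroup W.geomPoints := H.map (geomTorsion W (p : ℤ)).subtype with hS
  have hScard : Nat.card S = p := by
    rw [← hHcard]
    exact Nat.card_congr (H.equivMapOfInjective _ (geomTorsion W (p : ℤ)).subtype_injective).symm
  have hSstab : ∀ (σ : Field.absoluteGaloisGroup ℚ) (P : W.geomPoints),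
      P ∈ S → σ • P ∈ S := by
    rintro σ P ⟨Q, hQ, rfl⟩
    exact ⟨σ • Q, hHstab σ Q hQ, rfl⟩
  haveI : Finite S := Nat.finite_of_card_ne_zero (hScard ▸ hp.ne_zero)
  have hSne : S ≠ ⊥ := by
    intro h
    rw [h, AddSubgroup.card_bot] at hScard
    exact hp.one_lt.ne hScard
  obtain ⟨⟨s₀, hs₀S⟩, hs₀⟩ := AddSubgroup.ne_bot_iff_exists_ne_zero.1 hSne
  have hs₀0 : s₀ ≠ 0 := fun h0 ↦ hs₀ (Subtype.ext h0)
  have hps₀ : p • s₀ = 0 := by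
    have h0 : Nat.card S • (⟨s₀, hs₀S⟩ : S) = 0 := card_nsmul_eq_zero'
    rw [hScard] at h0
    have := congrArg Subtype.val h0
    rwa [AddSubmonoidClass.coe_nsmul] at this
  have hord₀ : addOrderOf s₀ = p := addOrderOf_eq_prime hps₀ hs₀0
  have hSeq : S = AddSubgroup.zmultiples s₀ := by
    symm
    apply AddSubgroup.eq_of_le_of_card_ge (AddSubgroup.zmultiples_le.2 hs₀S)
    rw [hScard, Nat.card_zmultiples, hord₀]
  /- Step 2: two independent rational `2`-torsion points `P, Q`, and `E[2] = {O, P, Q, P + Q}`. -/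
  have h2K : ((2 : ℕ) : ℚ) ≠ 0 := by norm_num
  haveI : Finite (geomTorsion W ((2 : ℕ) : ℤ)) := finite_geomTorsion_natCast W two_ne_zero
  obtain ⟨P, Q, hP2, hQ2, hP0, hQ0, hPQ⟩ :
      ∃ P Q : W.geomPoints, 2 • P = 0 ∧ 2 • Q = 0 ∧ P ≠ 0 ∧ Q ≠ 0 ∧ P ≠ Q := by
    haveI : Fintype (geomTorsion W ((2 : ℕ) : ℤ)) := Fintype.ofFinite _
    have h3 : 2 < Fintype.card (geomTorsion W ((2 : ℕ) : ℤ)) := by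
      rw [← Nat.card_eq_fintype_card, natCard_geomTorsion_eq_sq W h2K]; norm_num
    obtain ⟨a, b, c, hab, hac, hbc⟩ := Fintype.two_lt_card_iff.1 h3
    have mem2 : ∀ x : geomTorsion W ((2 : ℕ) : ℤ), 2 • (x : W.geomPoints) = 0 := fun x ↦
      AddSubgroup.torsionBy.nsmul_iff.1 x.2
    have hne : ∀ {x y : geomTorsion W ((2 : ℕ) : ℤ)}, x ≠ y → (x : W.geomPoints) ≠ y :=
      fun hxy h ↦ hxy (Subtype.ext h)
    by_cases ha : (a : W.geomPoints) = 0
    · refine ⟨b, c, mem2 b, mem2 c, fun hb ↦ hne hab (ha.trans hb.symm), fun hc ↦ hne hac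
        (ha.trans hc.symm), hne hbc⟩
    · by_cases hb : (b : W.geomPoints) = 0
      · exact ⟨a, c, mem2 a, mem2 c, ha, fun hc ↦ hne hbc (hb.trans hc.symm), hne hac⟩
      · exact ⟨a, b, mem2 a, mem2 b, ha, hb, hne hab⟩
  have hE2 : ∀ {T : W.geomPoints}, 2 • T = 0 → T = 0 ∨ T = P ∨ T = Q ∨ T = P + Q :=
    fun hT ↦ W.eq_zero_or_eq_or_eq_add_of_two_nsmul_eq_zero two_ne_zero hP2 hQ2 hP0 hQ0 hPQ hT
  -- Galois commutes with multiplication by integers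
  have hsm : ∀ (V : WeierstrassCurve ℚ) (σ : Field.absoluteGaloisGroup ℚ) (k : ℤ)
      (X : V.geomPoints), σ • (k • X) = k • σ • X :=
    fun V σ k X ↦ smul_comm σ k X
  have hsmn : ∀ (V : WeierstrassCurve ℚ) (σ : Field.absoluteGaloisGroup ℚ) (k : ℕ)
      (X : V.geomPoints), σ • (k • X) = k • σ • X :=
    fun V σ k X ↦ smul_comm σ k X
  -- a half `R` of `P`
  obtain ⟨R, hR⟩ : ∃ R : W.geomPoints, ((2 : ℕ) : ℤ) • R = P :=
    (W.baseChange (AlgebraicClosure ℚ)).zsmul_surjective_of_isAlgClosed (by norm_num) P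
  rw [natCast_zsmul] at hR
  /- Step 3: the `2`-isogeny `g₁ : E → E₁ = E/⟨Q⟩`. -/
  set CQ : AddSubgroup W.geomPoints := AddSubgroup.zmultiples Q with hCQ
  have hordQ : addOrderOf Q = 2 := addOrderOf_eq_prime hQ2 hQ0
  have hCQcard : Nat.card CQ = 2 := by rw [Nat.card_zmultiples, hordQ]
  have hCQfin : (CQ : Set W.geomPoints).Finite := by
    have h : Nat.card CQ ≠ 0 := by rw [hCQcard]; decide
    exact Nat.finite_of_card_ne_zero h
  have hCQstab : ∀ (σ : Field.absoluteGaloisGroup ℚ) (X : W.geomPoints), X ∈ CQ → σ • X ∈ CQ := by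
    intro σ X hX
    rw [AddSubgroup.mem_zmultiples_iff] at hX
    obtain ⟨k, rfl⟩ := hX
    rw [hsm W σ k Q, h2 σ Q hQ2]
    exact AddSubgroup.zsmul_mem _ (AddSubgroup.mem_zmultiples Q) k
  obtain ⟨E₁, hE₁, g₁, -, hker₁, -, -⟩ :=
    W.exists_isogeny_ker_eq_and_comp_eq_nsmul_holds CQ hCQfin hCQstab
  haveI := hE₁
  have hg₁Q : g₁ Q = 0 := by
    have : Q ∈ g₁.toAddMonoidHom.ker := hker₁ ▸ AddSubgroup.mem_zmultiples Q
    exact this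
  have hCQmem : ∀ X : W.geomPoints, X ∈ CQ → X = 0 ∨ X = Q := by
    intro X hX
    rw [AddSubgroup.mem_zmultiples_iff] at hX
    obtain ⟨k, rfl⟩ := hX
    rcases Int.even_or_odd k with ⟨j, rfl⟩ | ⟨j, rfl⟩
    · left
      rw [add_zsmul, ← zsmul_add, ← two_nsmul, hQ2, zsmul_zero]
    · right
      rw [add_zsmul, one_zsmul, add_eq_right, two_mul, add_zsmul, ← zsmul_add, ← two_nsmul, hQ2,
        zsmul_zero]
  have hg₁ker : ∀ X : W.geomPoints, g₁ X = 0 → X = 0 ∨ X = Q := fun X hX ↦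
    hCQmem X (by rw [← hker₁]; exact hX)
  have hg₁P : g₁ P ≠ 0 := fun h ↦ by
    rcases hg₁ker P h with h' | h'
    · exact hP0 h'
    · exact hPQ h'
  have hg₁s₀ : g₁ s₀ ≠ 0 := fun h ↦ by
    rcases hg₁ker s₀ h with h' | h'
    · exact hs₀0 h'
    · have hdvd : addOrderOf s₀ ∣ 2 := addOrderOf_dvd_iff_nsmul_eq_zero.2 (by rw [h']; exact hQ2)
      rw [hord₀] at hdvd
      have := Nat.le_of_dvd two_pos hdvd
      omega
  /- Step 4: the cyclic `Γ_ℚ`-stable subgroup `K = ⟨κ⟩`, `κ = g₁ R + g₁ s₀`, of order `4p`. -/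
  set x : E₁.geomPoints := g₁ R with hx
  set y : E₁.geomPoints := g₁ s₀ with hy
  have h2x : 2 • x = g₁ P := by rw [hx, ← map_nsmul, hR]
  have h4x : 4 • x = 0 := by
    rw [show (4 : ℕ) = 2 * 2 by norm_num, ← smul_smul, h2x, ← map_nsmul, hP2, map_zero]
  have hordx : addOrderOf x = 4 := by
    have e := addOrderOf_eq_prime_pow (p := 2) (n := 1) (x := x)
      (by rw [pow_one, h2x]; exact hg₁P) (by norm_num; exact h4x)
    norm_num at e
    exact e
  have hpy : p • y = 0 := by rw [hy, ← map_nsmul, hps₀, map_zero]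
  have hordy : addOrderOf y = p := addOrderOf_eq_prime hpy hg₁s₀
  have hcop : Nat.Coprime 4 p := by
    have e := ((Nat.coprime_primes Nat.prime_two hp).2 (Ne.symm hp2)).pow_left 2
    norm_num at e
    exact e
  have h4p0 : 4 * p ≠ 0 := by omega
  set κ : E₁.geomPoints := x + y with hκ
  have hordκ : addOrderOf κ = 4 * p := by
    rw [hκ, (AddCommute.all x y).addOrderOf_add_eq_mul_addOrderOf_of_coprime
      (by rw [hordx, hordy]; exact hcop), hordx, hordy]
  set Ks : AddSubgroup E₁.geomPoints := AddSubgroup.zmultiples κ with hKs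
  have hKcard : Nat.card Ks = 4 * p := by rw [Nat.card_zmultiples, hordκ]
  have hKfin : (Ks : Set E₁.geomPoints).Finite := by
    have h : Nat.card Ks ≠ 0 := by rw [hKcard]; exact h4p0
    exact Nat.finite_of_card_ne_zero h
  have hκK : κ ∈ Ks := AddSubgroup.mem_zmultiples κ
  have hxK : x ∈ Ks := by
    -- `x = (p * p) • κ` since `p² ≡ 1 (mod 4)` and `p • y = 0`
    obtain ⟨t, ht⟩ := hpodd
    have hppx : (p * p) • x = x := by
      have e : p * p = (t * t + t) * 4 + 1 := by rw [ht]; ring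
      rw [e, add_nsmul, one_nsmul, ← smul_smul, h4x, smul_zero, zero_add]
    have hppy : (p * p) • y = 0 := by rw [← smul_smul, hpy, smul_zero]
    have e : (p * p) • κ = x := by rw [hκ, nsmul_add, hppx, hppy, add_zero]
    rw [← e]
    exact Ks.nsmul_mem hκK _
  have hyK : y ∈ Ks := by
    have e : y = κ - x := by rw [hκ, add_sub_cancel_left]
    rw [e]
    exact Ks.sub_mem hκK hxK
  -- images under `g₁` of the `2`-torsion and of `S` lie in `K`
  have hPQ0 : g₁ (P + Q) = 2 • x := by rw [map_add, hg₁Q, add_zero, h2x]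
  have hg₁2 : ∀ {T : W.geomPoints}, 2 • T = 0 → g₁ T ∈ Ks := by
    intro T hT
    rcases hE2 hT with rfl | rfl | rfl | rfl
    · rw [map_zero]; exact Ks.zero_mem
    · rw [← h2x]; exact Ks.nsmul_mem hxK 2
    · rw [hg₁Q]; exact Ks.zero_mem
    · rw [hPQ0]; exact Ks.nsmul_mem hxK 2
  have hg₁S : ∀ {s : W.geomPoints}, s ∈ S → g₁ s ∈ Ks := by
    intro s hs
    rw [hSeq, AddSubgroup.mem_zmultiples_iff] at hs
    obtain ⟨k, rfl⟩ := hs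
    rw [map_zsmul]
    exact Ks.zsmul_mem hyK k
  have hKstab : ∀ (σ : Field.absoluteGaloisGroup ℚ) (X : E₁.geomPoints), X ∈ Ks → σ • X ∈ Ks := by
    intro σ X hX
    rw [AddSubgroup.mem_zmultiples_iff] at hX
    obtain ⟨k, rfl⟩ := hX
    rw [hsm E₁ σ k κ]
    refine Ks.zsmul_mem ?_ k
    have hσR : 2 • (σ • R - R) = 0 := by
      rw [nsmul_sub, ← hsmn W σ 2 R, hR, h2 σ P hP2, sub_self]
    have e : σ • κ = g₁ (σ • R - R) + x + g₁ (σ • s₀) := by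
      rw [hκ, smul_add, hx, hy, ← g₁.map_smul, ← g₁.map_smul, map_sub, sub_add_cancel]
    rw [e]
    exact Ks.add_mem (Ks.add_mem (hg₁2 hσR) hxK) (hg₁S (hSstab σ s₀ hs₀S))
  /- Step 5: the quotient isogeny `g₂ : E₁ → E₂ = E₁/K` is a cyclic `ℚ`-isogeny of degree
  `#K = 4p` between elliptic curves over `ℚ` — excluded by `h4p`. -/
  obtain ⟨E₂, hE₂, g₂, -, hker₂, -, -⟩ :=
    E₁.exists_isogeny_ker_eq_and_comp_eq_nsmul_holds Ks hKfin hKstab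
  haveI := hE₂
  have hcyc : g₂.IsCyclic :=
    (AddSubgroup.isAddCyclic_iff_exists_zmultiples_eq_top _).mpr ⟨κ, by rw [hker₂, hKs]⟩
  have hdeg : g₂.degree = 4 * p := by
    rw [Isogeny.degree, hker₂, hKcard]
  exact h4p E₁ E₂ g₂ hcyc hdeg

/-! ## The Frey curves at `p = 5` -/

/-- **Frey rigidity at `5` from `X₀(20)(ℚ)` = cusps: every framed model of `E_(a,b)[5]` is
irreducible**, for coprime integers `a, b` with `ab(a+b) ≠ 0`, granted that no cyclic `ℚ`-isogeny
between elliptic curves over `ℚ` has degree `20` (Kubert 1976; Kenku 1982: `20` is not the degree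
of a rational cyclic isogeny).  The `2`-torsion of the Frey curve `y² = x(x − a)(x + b)` is
rational (`smul_eq_of_two_nsmul_eq_zero_freyCurve`, Darmon–Merel 1997, Lemma 1.2 (1)), so
`hasIrreducibleModPGaloisRep_of_rational_two_torsion_of_degree_ne` at `p = 5` (`4 · 5 = 20`)
makes `E[5]` irreducible, and irreducibility passes to framed models
(`BCDT.isIrreducible_of_hasIrreducibleModPGaloisRep`).  This refines the line's stub S4a: the
Mazur–Kenku classification is replaced by its single entry `20 ∉ kenkuDegrees`.
[cite: DarmonMerel1997, Thm. 2.2] -/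
theorem isIrreducible_freyCurve_five_of_degree_ne_twenty
    (h20 : ∀ (W₁ W₂ : WeierstrassCurve ℚ) [W₁.IsElliptic] [W₂.IsElliptic] (φ : Isogeny W₁ W₂),
      φ.IsCyclic → φ.degree ≠ 20) :
    ∀ a b : ℤ, IsCoprime a b → a * b * (a + b) ≠ 0 →
      ∀ ρ : ModPGaloisRep ℚ (ZMod 5) 2, (freyCurve a b).IsTorsionGaloisRep 5 ρ →
        FramedRep.IsIrreducible ρ := by
  intro a b _ h0 ρ hρ
  haveI := isElliptic_freyCurve h0
  exact isIrreducible_of_hasIrreducibleModPGaloisRep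
    (hasIrreducibleModPGaloisRep_of_rational_two_torsion_of_degree_ne (freyCurve a b)
      (fun σ _ hT ↦ smul_eq_of_two_nsmul_eq_zero_freyCurve h0 σ hT) Nat.prime_five (by decide)
      fun W₁ W₂ _ _ φ hφ ↦ h20 W₁ W₂ φ hφ) hρ

end Summit.ABC.ABC.Theorems

end
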